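import Summits.NavierStokesRegularity.FluidComputer.ClayBlowupForcedStrainCriteria
import HarnessLib

/-!
# NO SUB-SELF-SIMILAR GRADIENT RATE IN ANY `L^r`, `3/2 < r < ∞`, WITH THE CLAY FORCE:
# `‖∇u(t)‖_{L^r} ≤ C (T − t)^{−γ}` with `γ < 1 − 3/(2r)` is impossible for every Clay blow-up

Cell `ns-blowup`, seat `ns-blowup-ecbridge-2` (g9; the E–C endpoint theory seat). LABEL: E–C typing
(KERNEL — no named fact). WHAT THIS IS NOT: not Navier–Stokes evidence — a necessary condition on the
TYPE `ClayBlowup ν` (no inhabitant is claimed anywhere). Companion memo: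
`run/shared/lean/pub/ns-blowup/ecbridge2/ECBRIDGE-2-MEMO-8.md`.

The rate companion of `ClayBlowup.lintegral_gradient_eq_top_forced` (Beirão da Veiga with the Clay force,
`ClayBlowupForcedStrainCriteria`), exactly as `not_subLerayRate` is the rate companion of the Sohr corner:
a bound `‖∇u(t)‖_{L^r} ≤ C (T − t)^{−γ}` on `(0, T)` with `γ < 1 − 3/(2r)` would make the Beirão da Veiga
integral `∫₀ᵀ ‖∇u‖_{L^r}^{1/(1−3/(2r))}` converge. The self-similar gradient rate `(T − t)^{−(1−3/(2r))}`
(`∇u(x, t) = (T−t)^{−1} ∇U(x/√(T−t))`) is the borderline: `ClayBlowup.not_subGradientRate`, its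
`DesignedBlowup` twin, and the (C)-reading.

References: Berselli–Galdi 2002 (1.3) [cite: BerselliGaldi2002, (1.3) p. 3586]; J. Leray (1934), (3.16)
[cite: Leray1934, (3.16)]; Fefferman (C) [cite: FeffermanClay2006, (C)].
-/

noncomputable section

namespace Summit.NavierStokesRegularity.FluidComputer

open Set MeasureTheory Filter Topology Function
open scoped ENNReal ContDiff NNReal
open Literature.Analysis.FluidPDE
open Summit.NavierStokesRegularity.NavierStokesRegularity

namespace ClayBlowup

variable {ν : ℝ} (X : ClayBlowup ν)

/-- **NO SUB-SELF-SIMILAR GRADIENT RATE IN ANY `L^r`, WITH THE CLAY FORCE** (`ν > 0`, `3/2 < r < ∞`,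
`C ≥ 0`, `γ < 1 − 3/(2 r.toReal)`; no named fact): the bound `‖∇u(t)‖_{L^r} ≤ C (T − t)^{−γ}` on
`(0, T)` is impossible — its Beirão da Veiga integral would converge, against
`lintegral_gradient_eq_top_forced`. [cite: BerselliGaldi2002, (1.3) p. 3586] [cite: Leray1934, (3.16)] -/
theorem not_subGradientRate (hν : 0 < ν) {r : ℝ≥0∞} (hr : 3 / 2 < r) (hrtop : r ≠ ⊤) {C γ : ℝ}
    (hC : 0 ≤ C) (hγ : γ < 1 - 3 / (2 * r.toReal))
    (hrate : ∀ t ∈ Ioo 0 X.T,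
      eLpNorm (fderiv ℝ (X.u t)) r volume ≤ ENNReal.ofReal (C * (X.T - t) ^ (-γ))) : False := by
  have hLr : ∀ᵐ t ∂volume, t ∈ Ioo 0 X.T → eLpNorm (fderiv ℝ (X.u t)) r volume < ⊤ :=
    Eventually.of_forall fun t ht => (hrate t ht).trans_lt ENNReal.ofReal_lt_top
  have htop := X.lintegral_gradient_eq_top_forced hν hr hrtop hLr
  set θ : ℝ := 1 - 3 / (2 * r.toReal) with hθ
  -- `0 < θ`
  have hρ3 : 3 / 2 < r.toReal := by
    have h : ((3 / 2 : ℝ≥0∞)).toReal < r.toReal :=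
      (ENNReal.toReal_lt_toReal (ENNReal.div_ne_top (by norm_num) (by norm_num)) hrtop).2 hr
    have h32 : ((3 / 2 : ℝ≥0∞)).toReal = 3 / 2 := by
      rw [ENNReal.toReal_div, ENNReal.toReal_ofNat, ENNReal.toReal_ofNat]
    rw [h32] at h
    exact h
  have hρ0 : 0 < r.toReal := by linarith
  have hθ0 : 0 < θ := by
    rw [hθ, sub_pos, div_lt_one (by positivity)]; linarith
  set e : ℝ := 1 / θ with he
  have he0 : 0 ≤ e := by positivity
  have hγe : γ * e < 1 := by
    rw [he, mul_one_div, div_lt_one hθ0]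
    exact hγ
  have hfin := DesignedBlowup.lintegral_ofReal_rate_rpow_lt_top (γ := γ) X.T_pos hC hγe
  have hle : ∫⁻ t in Ioo 0 X.T, ENNReal.ofReal ((eLpNorm (fderiv ℝ (X.u t)) r volume).toReal ^ e) ≤
      ∫⁻ t in Ioo 0 X.T, ENNReal.ofReal ((C * (X.T - t) ^ (-γ)) ^ e) := by
    refine setLIntegral_mono' measurableSet_Ioo fun t ht => ENNReal.ofReal_le_ofReal ?_
    have hTt : 0 < X.T - t := by linarith [ht.2]
    have hM0 : 0 ≤ C * (X.T - t) ^ (-γ) := mul_nonneg hC (Real.rpow_nonneg hTt.le _)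
    have hN : (eLpNorm (fderiv ℝ (X.u t)) r volume).toReal ≤ C * (X.T - t) ^ (-γ) :=
      ENNReal.toReal_le_of_le_ofReal hM0 (hrate t ht)
    exact Real.rpow_le_rpow ENNReal.toReal_nonneg hN he0
  exact absurd (htop ▸ hle) (not_le.2 hfin)

end ClayBlowup

namespace DesignedBlowup

variable {ν : ℝ} (D : DesignedBlowup ν)

/-- **No sub-self-similar gradient rate for every designed forced blow-up.**
[cite: BerselliGaldi2002, (1.3) p. 3586] -/
theorem not_subGradientRate (hν : 0 < ν) {r : ℝ≥0∞} (hr : 3 / 2 < r) (hrtop : r ≠ ⊤) {C γ : ℝ}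
    (hC : 0 ≤ C) (hγ : γ < 1 - 3 / (2 * r.toReal))
    (hrate : ∀ t ∈ Ioo 0 D.T,
      eLpNorm (fderiv ℝ (D.u t)) r volume ≤ ENNReal.ofReal (C * (D.T - t) ^ (-γ))) : False :=
  D.toClayBlowup.not_subGradientRate hν hr hrtop hC hγ hrate

end DesignedBlowup

/-- **EVERY BREAKDOWN SCENARIO FOR (C) HAS NO SUB-SELF-SIMILAR GRADIENT RATE** (no named fact).
[cite: FeffermanClay2006, (C)] [cite: BerselliGaldi2002, (1.3) p. 3586] -/
theorem breakdownR3_gradientRate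
    (h : Summit.NavierStokesRegularity.NavierStokesRegularity.NavierStokesBreakdownR3)
    {ν : ℝ} (hν : 0 < ν) :
    ∃ X : ClayBlowup ν, ∀ (r : ℝ≥0∞), 3 / 2 < r → r ≠ ⊤ → ∀ C γ : ℝ, 0 ≤ C →
      γ < 1 - 3 / (2 * r.toReal) →
        ¬ ∀ t ∈ Ioo 0 X.T, eLpNorm (fderiv ℝ (X.u t)) r volume ≤ ENNReal.ofReal (C * (X.T - t) ^ (-γ)) := by
  obtain ⟨X⟩ := forall_nonempty_clayBlowup_of_breakdownR3 h ν hν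
  exact ⟨X, fun r hr hrtop C γ hC hγ hrate => X.not_subGradientRate hν hr hrtop hC hγ hrate⟩

end Summit.NavierStokesRegularity.FluidComputer

end
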